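import Summits.ABC.IUTFork.Joshi.ArchimedeanUntiltsJoshi
import Mathlib.Analysis.MeanInequalitiesPow
import Mathlib.Algebra.Order.AbsoluteValue.Basic
import HarnessLib

/-!
# Branch E (R-J row Y-28, E ROWS row R-52) — `|−|^s_ℂ` is an absolute value (triangle inequality) iff `s ≤ 1`

Proof-only companion of the abc-iut cell, branch E / RESCUE-J (rung LADDER-ABC:A2.E; abc-iut-E-t7, gen 7; the criterion form of
row Y-28 proposed by abc-iut-E-t44, E ROWS #8 row R-52).  0 definitions, no `Prop` fact, no instance, no `sorry`; classical real analysis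
from Mathlib only.  abc-iut-E-t38's `ATS2half.powAbs s = ‖·‖^s` ([J-II½] §2.3 p. 12 l. 4–10, «|−|^s_ℂ») is a valued field structure on `ℂ` in
Bourbaki's WEAK sense for every `s > 0` (`ATS2half.isValuedField_powAbs`, constant `A = 2^s`); it is an ABSOLUTE VALUE in Mathlib's
sense (`AbsoluteValue ℂ ℝ`: multiplicative, positive definite, GENUINE triangle inequality) exactly for `0 < s ≤ 1`:

* `powAbs_add_le` — `0 < s ≤ 1 ⟹ |x + y|^s ≤ |x|^s + |y|^s` (monotonicity of `t ↦ t^s` and Mathlib's subadditivity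
  `Real.rpow_add_le_add_rpow`);
* `exists_absoluteValue_powAbs` — for `0 < s ≤ 1` the absolute value with underlying function `powAbs s`;
* `not_powAbs_two_le` / `not_exists_absoluteValue_powAbs` — for `s > 1`, `|1 + 1|^s = 2^s > 2 = |1|^s + |1|^s`, so no absolute value has
  underlying function `powAbs s`;
* **`exists_absoluteValue_powAbs_iff`** — R-52: `∀ s > 0, (∃ v : AbsoluteValue ℂ ℝ, ⇑v = powAbs s) ↔ s ≤ 1`.

Located, not adjudicated: this is the classical dividing line behind Y-28's junction remark (the archimedean `|·|^s`, `s > 1`, of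
[J-II½] Def. 2.3.3 / Prop. 2.4.3 is a Bourbaki valuation but not an absolute value — abc-iut-E-t46's INFO «junction total only after
Artin re-normalisation»); nothing about [IUTchIII] Cor. 3.12 or any author is asserted; NOT an abc claim.
[claim: Joshi2023ATS2half, status: disputed] [cite: NeukirchANT1999, Ch. II §3]
bears_on: LADDER-ABC:A2.E
-/

noncomputable section

namespace Summit.ABC.IUTFork.Joshi.ATS2half.PowAbsCriterion

open Summit.ABC.IUTFork.Joshi.ATS2half

/-- **`0 < s ≤ 1 ⟹ |x + y|^s_ℂ ≤ |x|^s_ℂ + |y|^s_ℂ`**: `‖x + y‖^s ≤ (‖x‖ + ‖y‖)^s ≤ ‖x‖^s + ‖y‖^s` (monotonicity of `t ↦ t^s` for `s ≥ 0`,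
subadditivity of `t ↦ t^s` for `0 ≤ s ≤ 1`, Mathlib `Real.rpow_add_le_add_rpow`). [cite: NeukirchANT1999, Ch. II §3] -/
theorem powAbs_add_le {s : ℝ} (hs : 0 < s) (hs1 : s ≤ 1) (x y : ℂ) :
    powAbs s (x + y) ≤ powAbs s x + powAbs s y := by
  rw [powAbs_apply, powAbs_apply, powAbs_apply]
  calc ‖x + y‖ ^ s ≤ (‖x‖ + ‖y‖) ^ s := Real.rpow_le_rpow (norm_nonneg _) (norm_add_le x y) hs.le
    _ ≤ ‖x‖ ^ s + ‖y‖ ^ s := Real.rpow_add_le_add_rpow (norm_nonneg _) (norm_nonneg _) hs.le hs1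

/-- **For `0 < s ≤ 1`, `|−|^s_ℂ` IS an absolute value** (Mathlib `AbsoluteValue ℂ ℝ` with underlying function `powAbs s`: multiplicativity
and positive definiteness from `ATS2half.isValuedField_powAbs`, triangle inequality from `powAbs_add_le`). [cite: NeukirchANT1999, Ch. II §3] -/
theorem exists_absoluteValue_powAbs {s : ℝ} (hs : 0 < s) (hs1 : s ≤ 1) :
    ∃ v : AbsoluteValue ℂ ℝ, ⇑v = powAbs s := by
  refine ⟨{ toFun := powAbs s
            map_mul' := fun x y => (isValuedField_powAbs hs).map_mul x y
            nonneg' := fun x => (isValuedField_powAbs hs).nonneg x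
            eq_zero' := fun x => (isValuedField_powAbs hs).eq_zero_iff x
            add_le' := fun x y => powAbs_add_le hs hs1 x y }, ?_⟩
  rfl

/-- **For `s > 1` the triangle inequality FAILS at `1 + 1`**: `|2|^s_ℂ = 2^s > 2 = |1|^s_ℂ + |1|^s_ℂ`. [cite: NeukirchANT1999, Ch. II §3] -/
theorem not_powAbs_two_le {s : ℝ} (hs1 : 1 < s) :
    ¬ powAbs s ((1 : ℂ) + 1) ≤ powAbs s 1 + powAbs s 1 := by
  intro h
  rw [powAbs_apply, powAbs_apply, norm_one, Real.one_rpow] at h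
  have h2 : ‖(1 : ℂ) + 1‖ = 2 := by norm_num
  rw [h2] at h
  have hlt : (2 : ℝ) < (2 : ℝ) ^ s := by
    conv_lhs => rw [← Real.rpow_one 2]
    exact Real.rpow_lt_rpow_of_exponent_lt one_lt_two hs1
  linarith

/-- **For `s > 1` NO absolute value has underlying function `|−|^s_ℂ`.** [cite: NeukirchANT1999, Ch. II §3] -/
theorem not_exists_absoluteValue_powAbs {s : ℝ} (hs1 : 1 < s) :
    ¬ ∃ v : AbsoluteValue ℂ ℝ, ⇑v = powAbs s := by
  rintro ⟨v, hv⟩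
  refine not_powAbs_two_le hs1 ?_
  rw [← hv]
  exact v.add_le 1 1

/-- **R-52 (row Y-28 criterion form).**  For every `s > 0`: `|−|^s_ℂ` is (the underlying function of) an absolute value on `ℂ` — genuine
triangle inequality — if and only if `s ≤ 1`.  So the archimedean untilts `(ℂ, |−|^s_ℂ)` of [J-II½] Def. 2.3.3 / Prop. 2.4.3 are ABSOLUTE
values exactly on `0 < s ≤ 1` and merely Bourbaki-valued (`A = 2^s`) beyond. [claim: Joshi2023ATS2half, status: disputed]
[cite: NeukirchANT1999, Ch. II §3] -/
theorem exists_absoluteValue_powAbs_iff {s : ℝ} (hs : 0 < s) :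
    (∃ v : AbsoluteValue ℂ ℝ, ⇑v = powAbs s) ↔ s ≤ 1 := by
  constructor
  · intro h
    by_contra hs1
    exact not_exists_absoluteValue_powAbs (lt_of_not_ge hs1) h
  · exact exists_absoluteValue_powAbs hs

/-- … in the row's literal quantified form: `∀ s > 0, (∃ v : AbsoluteValue ℂ ℝ, ⇑v = powAbs s) ↔ s ≤ 1`.
[claim: Joshi2023ATS2half, status: disputed] [cite: NeukirchANT1999, Ch. II §3] -/
theorem forall_exists_absoluteValue_powAbs_iff :
    ∀ s : ℝ, 0 < s → ((∃ v : AbsoluteValue ℂ ℝ, ⇑v = powAbs s) ↔ s ≤ 1) :=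
  fun _ hs => exists_absoluteValue_powAbs_iff hs

end Summit.ABC.IUTFork.Joshi.ATS2half.PowAbsCriterion

end
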